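import Literature.IUT.HodgeTheaters.LocalFrobenioidsArch
import Literature.AlgebraicGeometry.Frobenioids.ArchimedeanPointBase
import HarnessLib

/-!
# [IUTchI] Example 3.4 (i): the archimedean Frobenioid `C_v` made REAL — a model of the interface
# `ArchLocalFrobenioid ℂ` whose `C_v` is THE category "`C`" of [FrdII] Example 3.3 over the one-morphism base

S. Mochizuki, *Inter-universal Teichmüller theory I*, §3, Example 3.4 (i), kurims text (May 2020) p. 80:
"write … `C_v` for the archimedean Frobenioid as in [FrdII], Example 3.3, (ii) [i.e., "`C`" of loc. cit.],
where we take the base category [i.e., "`D`" of loc. cit.] to be the one-morphism category determined by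
`Spec(K_v)` … by construction, there is a natural isomorphism `O^▷(C_v) ⥲ O^▷_{K_v}` of topological
monoids" [claim: Mochizuki2012, status: disputed].

This file (abc-iut cell; [FrdII]-side ingredients by abc-iut-L1-t6, `ArchimedeanPointBase.lean`) upgrades
the consistency witness `ArchLocalFrobenioid.trivial` of `LocalFrobenioidsWitness.lean` — whose `C_v` is the
terminal category, "a toy as far as `C_v`, `D_v` are concerned" — to a model whose `C_v` is the [FrdII]
construction itself at `K_v = ℂ`; `D_v` (Aut-holomorphic orbispace) and `𝒜_{D_v}` stay as in `trivial`
(those inputs are [AbsTopIII] interface data, abc-iut-L4-t2). Nothing of the series' disputed content is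
involved; no side is taken on [IUTchIII] Cor. 3.12.
-/

namespace Literature.IUT.HodgeTheaters

open CategoryTheory Literature.AlgebraicGeometry.Frobenioids

/-- `O^▷_ℂ` of the [FrdII]-side file is the L5 file's `unitDiscMonoid ℂ` (same definition).
[cite: Mochizuki2012, Ex 3.4 (i) p.80] -/
theorem ArchFrd_unitDisc_eq : ArchFrd.unitDisc = unitDiscMonoid ℂ := rfl

/-- **[IUTchI] Example 3.4 with the REAL archimedean Frobenioid `C_v`**: the interface
`ArchLocalFrobenioid ℂ` instantiated with `C_v := ` THE category "`C`" of [FrdII] Ex. 3.3 over the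
one-morphism base at `Spec ℂ` (`ArchFrd.Cpt`, a Frobenioid: `ArchFrd.Cpt.isFrobenioid`),
`O^▷(C_v) := O^▷(std 1)` = the base-identity linear endomorphisms of the pseudo-terminal isotropic object
([FrdI] Def. 1.2 (ii), found's `PreFrobenioid.endSubmonoid`) with the topology induced from `ℂ`, and the
natural isomorphism `O^▷(C_v) ⥲ O^▷_ℂ` = the scalar map (`ArchFrd.Cpt.endEquivUnitDisc`); `𝒜_{D_v} := ℂ`,
`D_v` a point (the [AbsTopIII] inputs remain interface, as in `ArchLocalFrobenioid.trivial`), `C^Θ_v := C_v`.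
Upgrades `ArchLocalFrobenioid.trivial` (whose `C_v` is the terminal category).
[cite: Mochizuki2012, Ex 3.4 (i) p.80] [claim: Mochizuki2012, status: disputed] -/
noncomputable def ArchLocalFrobenioid.ofArchFrd : ArchLocalFrobenioid.{0} ℂ where
  Dv := { carrier := PUnit, autHol := ⊥ }
  Afield := ℂ
  caf := ⟨RingEquiv.refl ℂ, continuous_id, continuous_id⟩
  Cv := ArchFrd.Cpt
  OC := PreFrobenioid.endSubmonoid (ArchFrd.C.toElem ArchFrd.ptBase) (ArchFrd.Cpt.std 1)
  instOCTop := ArchFrd.Cpt.endTopology 1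
  instOCMon := ArchFrd.Cpt.endCommMonoid 1
  instOCCts := ArchFrd.Cpt.endContinuousMul 1
  isoOK := ArchFrd.Cpt.endEquivUnitDisc 1
  isoOK_continuous := ArchFrd.Cpt.continuous_endEquivUnitDisc 1
  isoOK_continuous_symm := ArchFrd.Cpt.continuous_endEquivUnitDisc_symm 1
  fieldIso := RingEquiv.refl ℂ
  fieldIso_continuous := continuous_id
  fieldIso_continuous_symm := continuous_id
  CTheta := ArchFrd.Cpt
  dashThetaEquiv := CategoryTheory.Equivalence.refl

/-- The `C_v` of `ArchLocalFrobenioid.ofArchFrd` is a Frobenioid in the sense of [FrdI] Def. 1.3 (over the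
one-morphism base, with the pre-Frobenioid structure of [FrdII] Ex. 3.3 (i)); [FrdII] Ex. 3.3 (ii) via
abc-iut-L1-d7's `Ex33ii_isFrobenioid_holds`. [cite: Mochizuki2012, Ex 3.4 (i) p.80]
[cite: MochizukiFrdII2008, Ex 3.3 (ii) p.28] -/
theorem ArchLocalFrobenioid.ofArchFrd_isFrobenioid :
    PreFrobenioid.IsFrobenioid (ArchFrd.C.toElem ArchFrd.ptBase) := ArchFrd.Cpt.isFrobenioid

end Literature.IUT.HodgeTheaters
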